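import Mathlib
import Summits.KontsevichZagierPeriods.KontsevichZagierPeriods.Theorems.SoloInformedKZStokesCube
import HarnessLib

/-!
# SoloInformed — grid subdivision of the unit cube inside the KZ calculus

For `N ≥ 1` the closed unit cube `[0,1]ⁿ` is the union of the `Nⁿ` grid cells
`∏ₗ [jₗ/N, (jₗ+1)/N]`, `j : Fin n → Fin N`, which overlap in Lebesgue-null sets; each cell is
the image of the cube under the affine map `Φⱼ x = (j + x)/N` of Jacobian `N⁻ⁿ`. Consequently

  `[[0,1]ⁿ, f] − ∑ⱼ [[0,1]ⁿ, x ↦ N⁻ⁿ · f ((j + x)/N)] ∈ KZ.relations`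

(`soloInformed_grid_mem_relations`): finitely many domain-additivity moves (rule (1)) followed by
one change-of-variables move (rule (2)) per cell. This is the subdivision step of THEOREM P_A of the
solo-informed programme (it pushes the complex singularities of an integrand analytic near the
closed cube off Ayoub's polydisc of radius `> 1`, file `SoloInformedAyoubCubeAnalytic`).

Also proved here, for general use: **finite domain additivity**
(`soloInformed_of_sub_sum_mem_relations_of_biUnion`): if the domain of `r` is a finite union of
`ℚ`-semialgebraic sets `D j` with pairwise null overlaps and `r`'s integrand agrees with that of
`rs j` on `D j = (rs j).domain`, then `[r] − ∑ⱼ [rs j] ∈ KZ.relations`.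

References: Kontsevich–Zagier 2001, §1.2 rules (1), (2); compare the dyadic one-coordinate
subdivision move `KZ.cubicalSubdivGens_subset_relations` of
`Literature/NumberTheory/Transcendental/KZCubicalCalculus.lean` (Ayoub 2014, Def. 10).
-/

noncomputable section

open scoped BigOperators
open MeasureTheory Set
open Literature.NumberTheory.Transcendental Literature.NumberTheory.Transcendental.KZ
open Literature.ModelTheory.ExponentialFields (IsSemialgebraic isSemialgebraic_setOf_eval_le)

namespace Summit.KontsevichZagierPeriods.KontsevichZagierPeriods.Theorems

/-! ### Finite domain additivity -/

/-- **Finite domain additivity** (rule (1) iterated): if `r.domain = ⋃_{j ∈ s} D j` for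
`ℚ`-semialgebraic sets `D j` with pairwise Lebesgue-null intersections, `(rs j).domain = D j` and
`r.integrand = (rs j).integrand` on `D j`, then `[r] − ∑_{j ∈ s} [rs j] ∈ KZ.relations`.
[Kontsevich–Zagier 2001, §1.2 rule (1)] -/
theorem soloInformed_of_sub_sum_mem_relations_of_biUnion {n : ℕ} {ι : Type*} [DecidableEq ι]
    (D : ι → Set (Fin n → ℝ)) (hD : ∀ j, IsSemialgebraic ℚ (D j))
    (hnull : ∀ j j', j ≠ j' → volume (D j ∩ D j') = 0)
    (rs : ι → IntegralRep n) (hrs : ∀ j, (rs j).domain = D j) :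
    ∀ (s : Finset ι) (r : IntegralRep n), r.domain = ⋃ j ∈ s, D j →
      (∀ j ∈ s, EqOn r.integrand (rs j).integrand (D j)) →
      of r - ∑ j ∈ s, of (rs j) ∈ relations := by
  intro s
  induction s using Finset.induction_on with
  | empty =>
    intro r hr _
    simp only [Finset.sum_empty, sub_zero]
    refine of_mem_relations_of_volume_eq_zero r ?_
    rw [hr]
    simp
  | insert a s ha ih =>
    intro r hr hI
    have hsub : (⋃ j ∈ s, D j) ⊆ r.domain := by
      rw [hr]
      exact biUnion_subset_biUnion_left fun j hj => Finset.mem_insert_of_mem hj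
    set r' : IntegralRep n :=
      r.restrict (⋃ j ∈ s, D j) (IsSemialgebraic.biUnion s D fun j _ => hD j) hsub with hr'
    have hadd : of r - of (rs a) - of r' ∈ relations := by
      refine domainAddRel_subset_relations ⟨n, r, rs a, r', ?_, ?_, ?_, ?_, rfl⟩
      · rw [hr, hrs, hr', IntegralRep.domain_restrict, Finset.set_biUnion_insert]
      · rw [hrs, hr', IntegralRep.domain_restrict, inter_iUnion₂]
        refine nonpos_iff_eq_zero.1 ((measure_biUnion_finset_le s _).trans (le_of_eq ?_))
        refine Finset.sum_eq_zero fun j hj => hnull a j ?_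
        rintro rfl
        exact ha hj
      · rw [hrs]
        exact hI a (Finset.mem_insert_self a s)
      · exact fun _ _ => rfl
    have hrest : of r' - ∑ j ∈ s, of (rs j) ∈ relations :=
      ih r' (by rw [hr', IntegralRep.domain_restrict]) fun j hj => by
        rw [hr', IntegralRep.integrand_restrict]
        exact hI j (Finset.mem_insert_of_mem hj)
    rw [Finset.sum_insert ha, show of r - (of (rs a) + ∑ j ∈ s, of (rs j)) =
      (of r - of (rs a) - of r') + (of r' - ∑ j ∈ s, of (rs j)) by abel]
    exact relations.add_mem hadd hrest

/-- Finite domain additivity over a whole finite index type.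
[Kontsevich–Zagier 2001, §1.2 rule (1)] -/
theorem soloInformed_of_sub_sum_mem_relations_of_iUnion {n : ℕ} {ι : Type*} [Fintype ι]
    [DecidableEq ι] (D : ι → Set (Fin n → ℝ)) (hD : ∀ j, IsSemialgebraic ℚ (D j))
    (hnull : ∀ j j', j ≠ j' → volume (D j ∩ D j') = 0)
    (rs : ι → IntegralRep n) (hrs : ∀ j, (rs j).domain = D j) (r : IntegralRep n)
    (hr : r.domain = ⋃ j, D j) (hI : ∀ j, EqOn r.integrand (rs j).integrand (D j)) :
    of r - ∑ j, of (rs j) ∈ relations :=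
  soloInformed_of_sub_sum_mem_relations_of_biUnion D hD hnull rs hrs Finset.univ r
    (by rw [hr]; simp) fun j _ => hI j

/-! ### Grid cells and grid maps -/

/-- The grid cell `∏ₗ [jₗ/N, (jₗ+1)/N] ⊆ [0,1]ⁿ`. -/
def soloInformedGridCell {n : ℕ} (N : ℕ) (j : Fin n → Fin N) : Set (Fin n → ℝ) :=
  {y | ∀ l, ((j l : ℕ) : ℝ) / N ≤ y l ∧ y l ≤ (((j l : ℕ) : ℝ) + 1) / N}

/-- The grid map `Φⱼ x = (j + x)/N`, carrying the cube onto the cell `j`. -/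
def soloInformedGridMap {n : ℕ} (N : ℕ) (j : Fin n → Fin N) (x : Fin n → ℝ) : Fin n → ℝ :=
  fun l => (((j l : ℕ) : ℝ) + x l) / N

/-- Membership in a grid cell. -/
theorem soloInformed_mem_gridCell_iff {n N : ℕ} {j : Fin n → Fin N} {y : Fin n → ℝ} :
    y ∈ soloInformedGridCell N j ↔
      ∀ l, ((j l : ℕ) : ℝ) / N ≤ y l ∧ y l ≤ (((j l : ℕ) : ℝ) + 1) / N :=
  Iff.rfl

/-- Coordinates of the grid map. -/
@[simp] theorem soloInformedGridMap_apply {n : ℕ} (N : ℕ) (j : Fin n → Fin N)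
    (x : Fin n → ℝ) (l : Fin n) : soloInformedGridMap N j x l = (((j l : ℕ) : ℝ) + x l) / N := rfl

/-- Grid cells are `ℚ`-semialgebraic. [BCR 1998, §2.1] -/
theorem isSemialgebraic_soloInformedGridCell {n : ℕ} (N : ℕ) (j : Fin n → Fin N) :
    IsSemialgebraic ℚ (soloInformedGridCell N j) := by
  have h : soloInformedGridCell N j = ⋂ l ∈ (Finset.univ : Finset (Fin n)),
      ({y : Fin n → ℝ | MvPolynomial.aeval y (MvPolynomial.C (((j l : ℕ) : ℚ) / N)) ≤
          MvPolynomial.aeval y (MvPolynomial.X l : MvPolynomial (Fin n) ℚ)} ∩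
        {y : Fin n → ℝ | MvPolynomial.aeval y (MvPolynomial.X l : MvPolynomial (Fin n) ℚ) ≤
          MvPolynomial.aeval y (MvPolynomial.C ((((j l : ℕ) : ℚ) + 1) / N))}) := by
    ext y
    simp only [soloInformedGridCell, mem_setOf_eq, Finset.mem_univ, iInter_true, mem_iInter,
      mem_inter_iff, MvPolynomial.aeval_C, MvPolynomial.aeval_X, eq_ratCast]
    push_cast
    rfl
  rw [h]
  exact IsSemialgebraic.biInter _ _ fun l _ =>
    (isSemialgebraic_setOf_eval_le _ _).inter (isSemialgebraic_setOf_eval_le _ _)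

/-- Grid cells lie in the cube. -/
theorem soloInformedGridCell_subset_cube {n N : ℕ} (j : Fin n → Fin N) :
    soloInformedGridCell N j ⊆ soloInformedCube n := by
  intro y hy
  rw [soloInformed_mem_cube_iff]
  intro l
  have hl := hy l
  have hN : (0 : ℝ) < N := by
    have := (j l).pos
    exact_mod_cast this
  have hj1 : ((j l : ℕ) : ℝ) + 1 ≤ N := by exact_mod_cast (j l).isLt
  constructor
  · exact le_trans (div_nonneg (by positivity) hN.le) hl.1
  · exact hl.2.trans ((div_le_one hN).2 hj1)

/-- Every point of the cube lies in some grid cell (`N ≥ 1`). -/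
theorem soloInformed_exists_mem_gridCell {n N : ℕ} (hN : 0 < N) {x : Fin n → ℝ}
    (hx : x ∈ soloInformedCube n) : ∃ j : Fin n → Fin N, x ∈ soloInformedGridCell N j := by
  rw [soloInformed_mem_cube_iff] at hx
  have hNr : (0 : ℝ) < N := by exact_mod_cast hN
  refine ⟨fun l => ⟨min ⌊(N : ℝ) * x l⌋₊ (N - 1), (min_le_right _ _).trans_lt (Nat.sub_lt hN
    one_pos)⟩, fun l => ?_⟩
  obtain ⟨h0, h1⟩ := hx l
  have hfloor : (⌊(N : ℝ) * x l⌋₊ : ℝ) ≤ N * x l := Nat.floor_le (by positivity)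
  constructor
  · rw [div_le_iff₀ hNr]
    show ((min ⌊(N : ℝ) * x l⌋₊ (N - 1) : ℕ) : ℝ) ≤ x l * N
    calc ((min ⌊(N : ℝ) * x l⌋₊ (N - 1) : ℕ) : ℝ) ≤ ⌊(N : ℝ) * x l⌋₊ := by
          exact_mod_cast min_le_left _ _
      _ ≤ (N : ℝ) * x l := hfloor
      _ = x l * N := mul_comm _ _
  · rw [le_div_iff₀ hNr]
    show x l * N ≤ ((min ⌊(N : ℝ) * x l⌋₊ (N - 1) : ℕ) : ℝ) + 1
    by_cases hc : ⌊(N : ℝ) * x l⌋₊ ≤ N - 1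
    · rw [min_eq_left hc, mul_comm]
      exact (Nat.lt_floor_add_one ((N : ℝ) * x l)).le
    · rw [min_eq_right (not_le.1 hc).le]
      have hN1 : ((N - 1 : ℕ) : ℝ) + 1 = N := by
        rw [Nat.cast_sub (Nat.one_le_of_lt hN)]
        push_cast
        ring
      rw [hN1]
      calc x l * N ≤ 1 * N := by gcongr
        _ = N := one_mul _

/-- The cube is the union of the grid cells (`N ≥ 1`). -/
theorem soloInformed_iUnion_gridCell {n N : ℕ} (hN : 0 < N) :
    (⋃ j : Fin n → Fin N, soloInformedGridCell N j) = soloInformedCube n := by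
  refine Subset.antisymm (iUnion_subset fun j => soloInformedGridCell_subset_cube j)
    fun x hx => ?_
  obtain ⟨j, hj⟩ := soloInformed_exists_mem_gridCell hN hx
  exact mem_iUnion.2 ⟨j, hj⟩

/-- Distinct grid cells overlap in a Lebesgue-null set (a piece of a coordinate hyperplane). -/
theorem soloInformed_volume_gridCell_inter {n N : ℕ} {j j' : Fin n → Fin N} (hjj' : j ≠ j') :
    volume (soloInformedGridCell N j ∩ soloInformedGridCell N j') = 0 := by
  obtain ⟨l, hl⟩ := Function.ne_iff.1 hjj'
  have hN : (0 : ℝ) < N := by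
    have := (j l).pos
    exact_mod_cast this
  -- the overlap lies in the hyperplane `y l = max (j l) (j' l) / N`
  have hsub : soloInformedGridCell N j ∩ soloInformedGridCell N j' ⊆
      {y : Fin n → ℝ | y l = ((max (j l : ℕ) (j' l : ℕ) : ℕ) : ℝ) / N} := by
    rintro y ⟨hy, hy'⟩
    obtain ⟨h1, h2⟩ := hy l
    obtain ⟨h1', h2'⟩ := hy' l
    have hne : (j l : ℕ) ≠ (j' l : ℕ) := fun h => hl (Fin.ext h)
    rcases lt_or_gt_of_ne hne with hlt | hlt
    · have hle : ((j l : ℕ) : ℝ) + 1 ≤ (j' l : ℕ) := by exact_mod_cast hlt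
      rw [max_eq_right hlt.le]
      refine le_antisymm ?_ h1'
      exact h2.trans (div_le_div_of_nonneg_right hle hN.le)
    · have hle : ((j' l : ℕ) : ℝ) + 1 ≤ (j l : ℕ) := by exact_mod_cast hlt
      rw [max_eq_left hlt.le]
      refine le_antisymm ?_ h1
      exact h2'.trans (div_le_div_of_nonneg_right hle hN.le)
  exact measure_mono_null hsub
    (Measure.pi_hyperplane (fun _ : Fin n => (volume : Measure ℝ)) l _)

/-- The grid map is the affine map `x ↦ N⁻¹ • x + j/N`. -/
theorem soloInformedGridMap_eq {n : ℕ} (N : ℕ) (j : Fin n → Fin N) :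
    soloInformedGridMap N j = fun x => (N : ℝ)⁻¹ • x + fun l => ((j l : ℕ) : ℝ) / N := by
  funext x
  ext l
  simp only [soloInformedGridMap_apply, Pi.add_apply, Pi.smul_apply, smul_eq_mul]
  ring

/-- The grid map has derivative `N⁻¹ • id` within any set. -/
theorem soloInformed_hasFDerivWithinAt_gridMap {n : ℕ} (N : ℕ) (j : Fin n → Fin N)
    (s : Set (Fin n → ℝ)) (x : Fin n → ℝ) :
    HasFDerivWithinAt (soloInformedGridMap N j)
      ((N : ℝ)⁻¹ • ContinuousLinearMap.id ℝ (Fin n → ℝ)) s x := by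
  rw [soloInformedGridMap_eq]
  exact (((ContinuousLinearMap.id ℝ (Fin n → ℝ)).hasFDerivWithinAt).const_smul
    ((N : ℝ)⁻¹)).add_const _

/-- The Jacobian determinant of the grid map is `N⁻ⁿ`. -/
theorem soloInformed_det_gridMap_deriv (n N : ℕ) :
    ((N : ℝ)⁻¹ • ContinuousLinearMap.id ℝ (Fin n → ℝ)).det = ((N : ℝ)⁻¹) ^ n := by
  rw [ContinuousLinearMap.det, ContinuousLinearMap.toLinearMap_smul, ContinuousLinearMap.coe_id,
    LinearMap.det_smul, LinearMap.det_id, mul_one, Module.finrank_fintype_fun_eq_card,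
    Fintype.card_fin]

/-- The grid map is injective (`N ≥ 1`). -/
theorem soloInformed_gridMap_injective {n N : ℕ} (hN : 0 < N) (j : Fin n → Fin N) :
    Function.Injective (soloInformedGridMap N j) := by
  intro x y h
  ext l
  have hl := congr_fun h l
  have hNr : (N : ℝ) ≠ 0 := by exact_mod_cast hN.ne'
  simp only [soloInformedGridMap_apply] at hl
  field_simp at hl
  linarith

/-- The grid map sends the cube onto the cell `j` (`N ≥ 1`). -/
theorem soloInformed_image_gridMap_cube {n N : ℕ} (hN : 0 < N) (j : Fin n → Fin N) :
    soloInformedGridMap N j '' soloInformedCube n = soloInformedGridCell N j := by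
  have hNr : (0 : ℝ) < N := by exact_mod_cast hN
  ext y
  simp only [mem_image, soloInformed_mem_gridCell_iff, soloInformed_mem_cube_iff]
  constructor
  · rintro ⟨x, hx, rfl⟩ l
    obtain ⟨h0, h1⟩ := hx l
    simp only [soloInformedGridMap_apply]
    constructor
    · exact div_le_div_of_nonneg_right (by linarith) hNr.le
    · exact div_le_div_of_nonneg_right (by linarith) hNr.le
  · intro hy
    refine ⟨fun l => N * y l - (j l : ℕ), fun l => ?_, ?_⟩
    · obtain ⟨h0, h1⟩ := hy l
      rw [div_le_iff₀ hNr] at h0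
      rw [le_div_iff₀ hNr] at h1
      constructor <;> linarith
    · ext l
      simp only [soloInformedGridMap_apply]
      field_simp
      ring

/-- The grid map is a polynomial map over `ℚ`, hence `ℚ`-semialgebraic on the cube.
[BCR 1998, §2.2] -/
theorem soloInformed_isSemialgebraicMapOn_gridMap {n : ℕ} (N : ℕ) (j : Fin n → Fin N) :
    IsSemialgebraicMapOn ℚ (soloInformedCube n) (soloInformedGridMap N j) := by
  refine (isSemialgebraicMapOn_aeval (R := ℝ) (isSemialgebraic_soloInformedCube n)
    fun l : Fin n => MvPolynomial.C (((j l : ℕ) : ℚ) / N) +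
      MvPolynomial.C ((1 : ℚ) / N) * MvPolynomial.X l).congr fun x _ => ?_
  ext l
  simp only [soloInformedGridMap_apply, map_add, map_mul, MvPolynomial.aeval_C,
    MvPolynomial.aeval_X, eq_ratCast]
  push_cast
  ring

/-! ### The grid subdivision theorem -/

/-- **Grid subdivision inside the KZ calculus.** If `r` has domain `[0,1]ⁿ` and, for every
`j : Fin n → Fin N` (`N ≥ 1`), `rs j` has domain `[0,1]ⁿ` and integrand
`x ↦ N⁻ⁿ · r.integrand ((j + x)/N)` on it, then `[r] − ∑ⱼ [rs j] ∈ KZ.relations`: finite domain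
additivity over the grid cells, then one change of variables `Φⱼ x = (j + x)/N` (Jacobian `N⁻ⁿ`)
per cell. [Kontsevich–Zagier 2001, §1.2 rules (1), (2)] -/
theorem soloInformed_grid_mem_relations {n N : ℕ} (hN : 0 < N) (r : IntegralRep n)
    (hr : r.domain = soloInformedCube n) (rs : (Fin n → Fin N) → IntegralRep n)
    (hd : ∀ j, (rs j).domain = soloInformedCube n)
    (hI : ∀ j, ∀ x ∈ soloInformedCube n,
      (rs j).integrand x = (((N : ℝ)⁻¹) ^ n) * r.integrand (soloInformedGridMap N j x)) :
    of r - ∑ j, of (rs j) ∈ relations := by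
  classical
  -- the pieces of `r` over the cells
  have hsub : ∀ j : Fin n → Fin N, soloInformedGridCell N j ⊆ r.domain := fun j =>
    hr ▸ soloInformedGridCell_subset_cube j
  set p : (Fin n → Fin N) → IntegralRep n := fun j =>
    r.restrict (soloInformedGridCell N j) (isSemialgebraic_soloInformedGridCell N j) (hsub j)
    with hp
  -- rule (1): `[r] − ∑ⱼ [p j]`
  have hadd : of r - ∑ j, of (p j) ∈ relations :=
    soloInformed_of_sub_sum_mem_relations_of_iUnion (soloInformedGridCell N)
      (isSemialgebraic_soloInformedGridCell N)
      (fun _ _ h => soloInformed_volume_gridCell_inter h) p (fun _ => rfl) r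
      (by rw [hr, soloInformed_iUnion_gridCell hN]) fun _ _ _ => rfl
  -- rule (2): `[rs j] − [p j]` for every cell
  have hcov : ∀ j, of (rs j) - of (p j) ∈ relations := fun j => by
    refine changeOfVariablesRel_subset_relations ⟨n, rs j, p j, soloInformedGridMap N j,
      fun _ => (N : ℝ)⁻¹ • ContinuousLinearMap.id ℝ (Fin n → ℝ), ?_, ?_, ?_, ?_, ?_, rfl⟩
    · rw [hd]
      exact soloInformed_isSemialgebraicMapOn_gridMap N j
    · rw [hd]
      exact fun x _ => soloInformed_hasFDerivWithinAt_gridMap N j _ x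
    · exact (soloInformed_gridMap_injective hN j).injOn
    · rw [hd, hp, IntegralRep.domain_restrict, soloInformed_image_gridMap_cube hN]
    · intro x hx
      rw [hd] at hx
      rw [hI j x hx, soloInformed_det_gridMap_deriv, abs_of_nonneg (by positivity),
        mul_comm]
      rfl
  have heq :
      of r - ∑ j, of (rs j) = (of r - ∑ j, of (p j)) - ∑ j, (of (rs j) - of (p j)) := by
    rw [Finset.sum_sub_distrib]
    abel
  rw [heq]
  exact relations.sub_mem hadd (relations.sum_mem fun j _ => hcov j)

end Summit.KontsevichZagierPeriods.KontsevichZagierPeriods.Theorems
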